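import Summits.ABC.IUTFork.Joshi.FundamentalEstimateBLReadings
import Summits.ABC.IUTFork.Joshi.TestFundamentalEstimateBL
import HarnessLib

/-!
# TEST X-05 continued: the CONTAINER of [J-III] Def. 7.2.7 (`sup` over `ρ ∈ (0,1]`) versus the volume dictionary `Y_vol^{BL}` —
# R-J census rows C-042 / C-060 (Y-08 «BL») and the fixed-`ρ` form of the Thm. 7.3.1 line (Y-31 / Y-32)

Test-side, proof-only companion of the abc-iut cell, block E → R-J «JOSHI Y-DISCHARGE CENSUS» (D-0079; rung LADDER-ABC:A2.RESCUE.J);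
seat abc-iut-E-t12 (gen 8). Parents (BY NAME, nothing restated): X-05 `Joshi/TestFundamentalEstimateBL.lean` (p429522: `QVolumeReading`,
`ThetaVolumeReading`, `VolumeDictionaryBL`, `SummedDomination`, `statement_of_summedDomination`, the degenerate consistency model
`volumeDictionaryBL_trivialDatum_toySettingNE`) and `Joshi/FundamentalEstimateBLReadings.lean` (p454590: `|Θ̃|_{B_{L′}} = ⊤` from one
Frobenius-eigen coordinate, the witness `eigenDatum`). Source: K. Joshi, arXiv:2401.13508**v4** ([J-III]; unrefereed; bib
`Joshi2024ATS3`) Def. 7.2.7 p.54 l.61–76 (the size is a `sup` over the locus AND over `ρ ∈ (0,1]`), Thm. 7.3.1 p.55 l.1–30, proof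
p.56 l.62–109 (the inequality is established at a general `ρ` before «and so by definition»).

WHAT THE KERNEL RECORDS (located, not adjudicated; nothing of [IUTchIII] or of Joshi asserted).
1. **The container alone kills the Θ-half of X-05's dictionary.** `ThetaVolumeReading D P` («Joshi's size of the locus ≤ exp of OUR
   summed hull log-volume», C-042) is FALSE at EVERY setting `P` of OUR side as soon as `|Θ̃^{B_{L′}}_Joshi|_{B_{L′}} = ⊤`
   (`not_thetaVolumeReading_of_size_eq_top`), hence for every typed §7 datum whose locus holds ONE member with ONE `ρ`-unbounded
   coordinate — the Frobenius-eigen reading of Def. 6.4.3.1's `λ ≠ 0` lifts (p454590 §2; `not_volumeDictionaryBL_of_unbounded_coordinate`).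
   Witness: `eigenDatum` (p454590) realises `VolumeDictionaryBL` at NO setting — its Θ-half fails everywhere by the container (at the
   degenerate Statement-true setting `Cor312Vol.Checks.toySettingNE`, where the trivial datum realises the dictionary (p429522), its
   q-half fails as well, as for every datum with a bad place there) — `dictionary_container_profile`. So the satisfiability of X-05's
   `Y = VolumeDictionaryBL` (C-060) at a Statement-true `P` also depends on the Joshi datum's CONTAINER behaviour in `ρ`: a located rider
   on E-t13 g7's «realisable ⟺ Statement» reading (census-t13.tsv PART C), which realises the dictionary by `ρ`-tame data.
2. **The contentful line is the fixed-`ρ` one.** OUR READING `ThetaVolumeReadingAt D P ρ` (Joshi's size AT `ρ` ≤ exp of OUR summed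
   hull log-volume) is implied by the `ρ`-uniform reading at every `ρ ∈ (0,1]` (`thetaVolumeReadingAt_of_uniform`) and, together with
   `QVolumeReading` (C-041) and `ThetaFinite`, turns E-t12's repaired Thm. 7.3.1 AT `ρ` (`FundamentalEstimateBLAt ρ`, p432151) into
   OUR Statement (`statement_of_fundamentalEstimateBLAt`) — hence the LOCAL STEP C-054 at `ρ` does (`statement_of_localThetaEstimateAt_at`),
   and the charitable reading `StandardPointNorms` does at every `ρ` (`statement_of_standardPointNorms_at`); under the LITERAL reading
   with a singleton locus the fixed-`ρ` J is false (p454590 §3) and the line has no input. I.e. X-05 at fixed `ρ`: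
   FILLS-MODULO-`Y_ρ` with `J_ρ` READING-DECIDED (Y-32), S-BYPASSED as before (SD ⟺ Statement, p429522).
3. Degenerate consistency of the fixed-`ρ` line (non-vacuity by construction only): `trivialDatum` ∧ `toySettingNE` (p429522's model)
   satisfy `J_ρ ∧ Y_ρ ∧ ThetaFinite ∧ Statement` at every `ρ ∈ (0,1]` (`fixedRho_line_consistent`). Non-degenerate realisability of the
   uniform dictionary — hence of the fixed-`ρ` one, by 2. — is abc-iut-E-t13 g7's realisability file (not restated).

HONEST SCOPE. One new `Prop`-valued definition, `ThetaVolumeReadingAt` (OUR READING; the fixed-`ρ` twin of p429522's `ThetaVolumeReading`;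
NOT-IN-PRINT for §7, like its parent). Interface level over `ATS3.AdelicThetaDatum`; witnesses are interface-level real data. No
FACT-LIST row consumed. TAKES NO SIDE on [IUTchIII] Cor. 3.12, on Joshi's claims or on Mochizuki's report on them (Mochizuki /
Scholze–Stix / Joshi / Dupuy–Hilado); typed ≠ proved ≠ endorsed; NOT an abc claim; never «Joshi proves Cor. 3.12».
-/

noncomputable section

open Set Finset

namespace Summit.ABC.IUTFork.Joshi.ATS3

open Thm311 Cor312 Cor312Vol Summit.ABC.IUTFork.Joshi

/-! ## 1. The container kills the Θ-half of the `ρ`-uniform dictionary -/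

section Container

variable (D : AdelicThetaDatum) {T : ThetaIndex} {S : Situation T} (P : Cor312.Setting S)

/-- **`|Θ̃|_{B_{L′}} = ⊤ ⟹ ¬ ThetaVolumeReading D P` at EVERY setting `P`**: an infinite Joshi size is below no real number. [folklore] -/
theorem not_thetaVolumeReading_of_size_eq_top (h : D.size D.locus = ⊤) : ¬ ThetaVolumeReading D P := by
  intro hΘ
  unfold ThetaVolumeReading at hΘ
  rw [h, top_le_iff] at hΘ
  exact EReal.coe_ne_top _ hΘ

/-- Hence `|Θ̃|_{B_{L′}} = ⊤ ⟹ ¬ VolumeDictionaryBL D P` at every setting. [folklore] -/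
theorem not_volumeDictionaryBL_of_size_eq_top (h : D.size D.locus = ⊤) : ¬ VolumeDictionaryBL D P := fun hY =>
  not_thetaVolumeReading_of_size_eq_top D P h hY.2

/-- **X-05's dictionary is UNSATISFIABLE, at every setting of OUR side, for every typed §7 datum whose locus holds one member with one
`ρ`-unbounded coordinate** (the other coordinates at the bad places `≥ c > 0`) — the Frobenius-eigen reading of Def. 6.4.3.1's
`λ ≠ 0` lifts (p454590 `size_locus_eq_top_of_unbounded_coordinate`). [folklore] -/
theorem not_volumeDictionaryBL_of_unbounded_coordinate (z : D.Idx) {w₀ : D.W} (hw₀ : w₀ ∈ D.Vss) (j₀ : Fin D.lstar) {c : ℝ}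
    (hc : 0 < c) (hlow : ∀ ρ ∈ Set.Ioc (0 : ℝ) 1, ∀ w ∈ D.Vss, ∀ j : Fin D.lstar, c ≤ D.nrm w ρ (D.Xi z w j))
    (hunb : ∀ M : ℝ, ∃ ρ ∈ Set.Ioc (0 : ℝ) 1, M < D.nrm w₀ ρ (D.Xi z w₀ j₀)) : ¬ VolumeDictionaryBL D P :=
  not_volumeDictionaryBL_of_size_eq_top D P (D.size_locus_eq_top_of_unbounded_coordinate z hw₀ j₀ hc hlow hunb)

/-- **The witness `eigenDatum` (p454590) realises X-05's dictionary at NO setting of OUR side.** [folklore] -/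
theorem not_volumeDictionaryBL_eigenDatum : ¬ VolumeDictionaryBL eigenDatum P :=
  not_volumeDictionaryBL_of_size_eq_top eigenDatum P (eigenDatum_profile (ρ := 1) ⟨one_pos, le_rfl⟩).2.2.1

end Container

/-- **CONTAINER PROFILE at one Statement-true setting**: at c312-6's nonempty toy setting (Statement ∧ ThetaFinite in kernel) the
trivial datum realises `VolumeDictionaryBL` (p429522) while `eigenDatum` does not (its Θ-half fails at EVERY setting by the container,
`not_volumeDictionaryBL_eigenDatum`; at this degenerate setting its q-half fails too). So the satisfiability of X-05's `Y` at a
Statement-true `P` is not a function of `P` alone (located rider; degenerate stage on purpose). [folklore] -/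
theorem dictionary_container_profile :
    Cor312Vol.Checks.toySettingNE.Statement ∧ VolumeDictionaryBL trivialDatum Cor312Vol.Checks.toySettingNE ∧
      ¬ VolumeDictionaryBL eigenDatum Cor312Vol.Checks.toySettingNE :=
  ⟨volumeDictionaryBL_trivialDatum_toySettingNE.2.2.2, volumeDictionaryBL_trivialDatum_toySettingNE.2.1,
    not_volumeDictionaryBL_eigenDatum _⟩

/-! ## 2. The fixed-`ρ` dictionary and X-05 at fixed `ρ` -/

section FixedRho

variable (D : AdelicThetaDatum) {T : ThetaIndex} {S : Situation T} (P : Cor312.Setting S)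

/-- **`ThetaVolumeReadingAt` (OUR READING, NOT-IN-PRINT for [J-III] §7; fixed-`ρ` twin of p429522's `ThetaVolumeReading`)**: Joshi's size
of the locus AT `ρ`, `|Θ̃^{B_{L′}}_Joshi|_{B_{L′},ρ}` (Def. 7.2.7 (7.2.8)), is at most `exp` of OUR summed hull log-volume `thetaSum P`.
Candidate dictionary hypothesis for the repaired (fixed-`ρ`) Thm. 7.3.1 line; never asserted. [claim: Joshi2024ATS3, status: disputed] -/
def ThetaVolumeReadingAt (ρ : ℝ) : Prop := D.sizeAt D.locus ρ ≤ ((Real.exp (thetaSum P) : ℝ) : EReal)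

/-- The `ρ`-uniform Θ-reading implies the fixed-`ρ` one at every `ρ ∈ (0,1]` (`sizeAt ≤ size`). [folklore] -/
theorem thetaVolumeReadingAt_of_uniform (h : ThetaVolumeReading D P) {ρ : ℝ} (hρ : ρ ∈ Set.Ioc (0 : ℝ) 1) :
    ThetaVolumeReadingAt D P ρ :=
  (D.sizeAt_le_size D.locus hρ).trans h

/-- Thm. 7.3.1 AT `ρ` + the q-reading + the Θ-reading AT `ρ` ⟹ SD (transitivity and `log`; same two lines as p429522's
`summedDomination_of_fundamentalEstimateBL`). [folklore] -/
theorem summedDomination_of_fundamentalEstimateBLAt {ρ : ℝ} (hJ : D.FundamentalEstimateBLAt ρ) (hq : QVolumeReading D P)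
    (hΘ : ThetaVolumeReadingAt D P ρ) : SummedDomination P := by
  refine hq.trans ?_
  have h1 : ((D.qBound : ℝ) : EReal) ≤ ((Real.exp (thetaSum P) : ℝ) : EReal) := hJ.trans hΘ
  have h2 : D.qBound ≤ Real.exp (thetaSum P) := EReal.coe_le_coe_iff.1 h1
  exact (Real.log_le_log D.qBound_pos h2).trans (Real.log_exp _).le

/-- **X-05 AT FIXED `ρ`, STATEMENT-DIRECT**: E-t12's repaired Thm. 7.3.1 AT `ρ` (`FundamentalEstimateBLAt ρ`, p432151 — a hypothesis),
the q-reading, the Θ-reading AT `ρ` and the Corollary's finiteness clause give OUR typed Cor. 3.12 Statement. Kernel glue; no clause of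
Cor. 3.12 and no claim of Joshi is asserted. [folklore] -/
theorem statement_of_fundamentalEstimateBLAt {ρ : ℝ} (hJ : D.FundamentalEstimateBLAt ρ) (hq : QVolumeReading D P)
    (hΘ : ThetaVolumeReadingAt D P ρ) (hfin : P.ThetaFinite) : P.Statement :=
  statement_of_summedDomination P hfin (summedDomination_of_fundamentalEstimateBLAt D P hJ hq hΘ)

/-- **The printed proof's content at `ρ`**: the LOCAL STEP C-054 at `ρ` + the fixed-`ρ` dictionary ⟹ Statement. [folklore] -/
theorem statement_of_localThetaEstimateAt_at {ρ : ℝ} (hJ : D.LocalThetaEstimateAt ρ) (hq : QVolumeReading D P)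
    (hΘ : ThetaVolumeReadingAt D P ρ) (hfin : P.ThetaFinite) : P.Statement :=
  statement_of_fundamentalEstimateBLAt D P (D.fundamentalEstimateBLAt_of_localThetaEstimateAt hJ) hq hΘ hfin

/-- **Charitable reading**: `StandardPointNorms` (T13-01) + the fixed-`ρ` dictionary at ANY one `ρ ∈ (0,1]` ⟹ Statement (every `ℓ ≥ 5`).
Under the LITERAL reading with a singleton locus the hypothesis `FundamentalEstimateBLAt ρ` is FALSE (p454590
`not_fundamentalEstimateBLAt_of_literal_of_locus_eq`) and this line has no input — Y-32's reading-dependence, inherited. [folklore] -/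
theorem statement_of_standardPointNorms_at (h : D.StandardPointNorms) {ρ : ℝ} (hρ : ρ ∈ Set.Ioc (0 : ℝ) 1)
    (hq : QVolumeReading D P) (hΘ : ThetaVolumeReadingAt D P ρ) (hfin : P.ThetaFinite) : P.Statement :=
  statement_of_fundamentalEstimateBLAt D P (D.fundamentalEstimateBLAt_of_standardPointNorms h hρ) hq hΘ hfin

/-- The `ρ`-uniform X-05 line factors through the fixed-`ρ` one at `ρ = 1` (so nothing is lost by repairing the container). [folklore] -/
theorem statement_of_fundamentalEstimateBLAt_one_of_uniform (hJ : D.FundamentalEstimateBLAt 1) (hY : VolumeDictionaryBL D P)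
    (hfin : P.ThetaFinite) : P.Statement :=
  statement_of_fundamentalEstimateBLAt D P hJ hY.1 (thetaVolumeReadingAt_of_uniform D P hY.2 ⟨one_pos, le_rfl⟩) hfin

/-- **At a fixed `ρ` the pinned countermodel still refutes the (fixed-`ρ`) dictionary for every datum with `J_ρ`** (p419720: typed
Thm. 3.11, `BridgeHyps`, `PinnedRegions3` hold, Statement fails): the content of «§7 ⟹ Cor. 3.12» sits in the dictionary at fixed `ρ` too.
[folklore] -/
theorem not_fixedRho_dictionary_pinnedSetting (p : ℕ) [Fact p.Prime] {ρ : ℝ} (hJ : D.FundamentalEstimateBLAt ρ) :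
    ¬ (QVolumeReading D (Cor312Vol.PinnedWitness.pinnedSetting p) ∧
        ThetaVolumeReadingAt D (Cor312Vol.PinnedWitness.pinnedSetting p) ρ) := fun h =>
  Cor312Vol.PinnedWitness.pinnedSetting_not_statement p
    (statement_of_fundamentalEstimateBLAt D _ hJ h.1 h.2 (Cor312Vol.PinnedWitness.pinnedSetting_bridgeHyps p).finite)

end FixedRho

/-! ## 3. Degenerate consistency of the fixed-`ρ` line -/

/-- `sizeAt` of the trivial locus is `≤ 1` at every `ρ`. [folklore] -/
theorem trivialDatum_sizeAt_le_one (ρ : ℝ) : trivialDatum.sizeAt trivialDatum.locus ρ ≤ 1 := by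
  refine trivialDatum.sizeAt_le_coe (C := 1) ?_
  rintro x ⟨z, rfl⟩
  rw [trivialDatum_adelicSize]

/-- **Degenerate joint consistency of the fixed-`ρ` line** (non-vacuity by construction only, as in p429522 §5): the trivial datum and
c312-6's nonempty toy setting satisfy `J_ρ` (Thm. 7.3.1 at `ρ`), `Y_ρ` (both readings, Θ-side at `ρ`), `ThetaFinite` and the Statement at
every `ρ` (so at every `ρ ∈ (0,1]`). Non-degenerate realisations: E-t13 g7's realisability file, transported by
`thetaVolumeReadingAt_of_uniform`. [folklore] -/
theorem fixedRho_line_consistent (ρ : ℝ) :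
    trivialDatum.FundamentalEstimateBLAt ρ ∧ QVolumeReading trivialDatum Cor312Vol.Checks.toySettingNE ∧
      ThetaVolumeReadingAt trivialDatum Cor312Vol.Checks.toySettingNE ρ ∧
        Cor312Vol.Checks.toySettingNE.ThetaFinite ∧ Cor312Vol.Checks.toySettingNE.Statement := by
  have hq : QVolumeReading trivialDatum Cor312Vol.Checks.toySettingNE := volumeDictionaryBL_trivialDatum_toySettingNE.2.1.1
  have hΘ : ThetaVolumeReadingAt trivialDatum Cor312Vol.Checks.toySettingNE ρ := by
    unfold ThetaVolumeReadingAt; rw [toySettingNE_thetaSum, Real.exp_zero]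
    exact_mod_cast trivialDatum_sizeAt_le_one ρ
  have hJ : trivialDatum.FundamentalEstimateBLAt ρ := by
    unfold AdelicThetaDatum.FundamentalEstimateBLAt
    rw [trivialDatum_qBound]
    have h := trivialDatum.adelicSize_le_sizeAt (trivialDatum.Xi_mem_locus ()) ρ
    rwa [trivialDatum_adelicSize] at h
  exact ⟨hJ, hq, hΘ, Cor312Vol.Checks.toySettingNE_thetaFinite,
    statement_of_fundamentalEstimateBLAt _ _ hJ hq hΘ Cor312Vol.Checks.toySettingNE_thetaFinite⟩

/-! ## 4. Package for the census (rows C-042 / C-060 rider; Y-31 / Y-32 fixed-`ρ` line) -/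

/-- **R-J PACKAGE** (kernel facts BY NAME; located, not adjudicated): (1) for every typed §7 datum with `|Θ̃|_{B_{L′}} = ⊤` (e.g. one
Frobenius-eigen coordinate, p454590) X-05's `ρ`-uniform dictionary fails at EVERY setting; (2) at fixed `ρ` the line
`J_ρ ∧ QVolumeReading ∧ ThetaVolumeReadingAt ρ ∧ ThetaFinite ⟹ Statement` holds for every datum and setting, with `J_ρ` supplied by
the local step C-054 at `ρ` (hence by `StandardPointNorms`; refuted under the literal reading with singleton locus, p454590); (3) the
uniform line factors through `ρ = 1`. [folklore] -/
theorem census_container_fixedRho (D : AdelicThetaDatum) {T : ThetaIndex} {S : Situation T} (P : Cor312.Setting S) :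
    (D.size D.locus = ⊤ → ¬ VolumeDictionaryBL D P) ∧
    (∀ ρ : ℝ, D.LocalThetaEstimateAt ρ → QVolumeReading D P → ThetaVolumeReadingAt D P ρ → P.ThetaFinite → P.Statement) ∧
    (D.FundamentalEstimateBLAt 1 → VolumeDictionaryBL D P → P.ThetaFinite → P.Statement) :=
  ⟨not_volumeDictionaryBL_of_size_eq_top D P, fun _ hJ hq hΘ hfin => statement_of_localThetaEstimateAt_at D P hJ hq hΘ hfin,
    statement_of_fundamentalEstimateBLAt_one_of_uniform D P⟩

end Summit.ABC.IUTFork.Joshi.ATS3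

end
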